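import Literature.NumberTheory.GaloisCohomology.Howard2004.DualityDatumTateDualBridge
import Literature.NumberTheory.GaloisRepresentations.LocalCupProductPerfectPairingProofs
import Literature.NumberTheory.GaloisRepresentations.LocalGlobalCohomologyTateProofs
import HarnessLib

/-!
# Howard 2004, H.4 at `v ∣ p`: the RESTRICTED pairing `Fil_v T × Tw(T)/Fil′ → R(1)` of a duality datum and the
# non-degeneracy of its cup product (theorems only; no definition, no named fact, no instance, no `sorry`)

Topic `NumberTheory/GaloisCohomology/Howard2004` (sequel to `DualityDatumTateDualBridge`, `DualityDatumLocalCupPerfectProofs`,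
`DualityDatumIsotropy`; cell `pub/bsd-print-x9`, brick (B3) of `HOME/p1/H4-EXACT-AT-P-PLAN`).

Howard [B. Howard, Compositio Math. 140 (2004), §1.3 H.4 and Lemma 3.1.1, Def. 3.2.6; arXiv:1202.6340 p. 7 L69–82, p. 15 L60–62,
p. 16 L108–110]: H.4 asks that the local condition be its own exact orthogonal complement under the induced local pairing
`H¹(K_v, T) × H¹(K_v̄, T) → R`; at `v ∣ p` the ordinary condition is `im H¹(K_v, Fil_v T)` and «`Fil_v(T_𝔭)` is its own exact
orthogonal complement under `e_𝔭`» (Lemma 3.1.1), so that `e_𝔭` induces a PERFECT pairing `Fil_v T × Tw(T)/Fil′ → R(1)`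
(`Fil′` the transported plus part at `v̄`), whose cup product `H¹(K_v, Fil_v T) × H¹(K_v, Tw(T)/Fil′) → H²(K_v, R(1))` is
non-degenerate by local Tate duality — the input (Nondeg′) of the tree's limit descent `Tower.pow_smul_eq_zero_of_forall_pairing_eq_zero`
(H.4 for the saturated `F_𝔮` at `v ∣ p`, where the full `H¹(K_v, T_𝔮)` is not torsion).  For a datum `D : DualityDatum p cd ρ R`,
a finite place `v`, a `Γ_{K_v}`-stable `V ≤ T` and a `Γ_{K_v}`-stable `V′ ≤ Tw(T)` with `D.e(V, V′) = 0`: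

* §1 **`DualityDatum.exists_restrictedPairing`** — there is a continuous equivariant pairing
  `P : V × (Tw(T)/V′) → R(1)|_{Γ_{K_v}}` on the tree's carriers `(GaloisRep.toLocal v ρ).subrepresentation V hV`,
  `(GaloisRep.toLocal v (cd.twist ρ)).quotient V′ hV′` (the currency of `OrdinaryFiltration.ordinaryCore` /
  `DiscreteGaloisModule.strictSubgroup (GaloisRep.toLocal v ·)`, over Mathlib's `v.adicCompletion K`) with
  `P(s, [t]) = D.e s t` (descend `D.e` by `Submodule.liftQ`);
* §2 **`DualityDatum.restrictedPairing_cupProduct_nondegenerate`** (+ the two one-sided forms) — for ANY such `P`, if the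
  `λ`-reading of `D.e` restricted to `V` is PERFECT towards `Tw(T)/V′` at the module level ((hR) `{t | λ e(V, t) = 0} ⊆ V′`,
  (hS) every additive `V → ℤ/p^k` is `λ e(·, t)|_V`) for a reading `λ : R → ℤ/p^k`, `exp : ℤ/p^k ≅ μ_{p^k}` as in
  `DualityDatumTateDualBridge`, then BOTH kernels of `P.cupProduct : H¹(K_v, V) × H¹(K_v, Tw(T)/V′) → H²(K_v, R(1))` are trivial.
  Proof: push `P` along `exp ∘ λ : R(1) → μ_{p^k}(K̄)` and `μ_{p^k}(K̄) ≅ μ_{p^k}(K̄_v)` (`muLocalIso`) to a `μ`-valued pairing of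
  LOCAL modules, perfect at the module level, and apply `ContPairing.eq_zero_of_forall_cupProduct_eq_zero_right/left`
  (`LocalCupProductPerfectPairingProofs`: the tree's PROVED local Tate duality `localDuality_bijective` for `Γ_{K_v}`-modules —
  `V`, `Tw(T)/V′` are NOT restrictions of `Γ_K`-modules, so the Poitou–Tate binder `LocalInvariants.IsPerfect` does not apply).
  The statements carry `[CharZero (v.adicCompletion K)]` (discharge: `charZero_adicCompletion v`), which makes `Γ_{K_v}` compact
  for the cup product.

Nothing about any curve is asserted; the Eisenstein/`E`-instance ((hR)/(hS) from `Fil_v^⊥ = Fil_v` under the Weil pairing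
and `τ Fil_{v̄} = Fil_v`) is the next file.  No summit statement is proved; BSD is not proved by any of this.

References: [Howard2004HeegnerKolyvagin] §1.3 H.4, Lemma 2.1.1, Lemma 3.1.1, Def. 3.2.6 (arXiv:1202.6340 p. 7 L69–82, p. 15 L60–62,
p. 16 L108–110); [MilneADT2006] I §0 (pairings, `M^D`), I Cor. 2.3; [SerreGaloisCohomology1997] II §5.2 Thm. 2;
[NeukirchSchmidtWingberg2008] I §4 (1.4.2); [GreenbergLNM1716] §2 (the ordinary condition `im H¹(F⁺)`).
-/

set_option autoImplicit false

noncomputable section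

open CategoryTheory Function NumberField IsDedekindDomain Field
open scoped ContRepresentation NumberField

namespace Literature.NumberTheory.GaloisCohomology.Howard2004

open Literature.NumberTheory.GaloisRepresentations
open Literature.NumberTheory.GaloisRepresentations.DiscreteGaloisModule

variable {K : Type} [Field K] [NumberField K] {M : Type} [AddCommGroup M] [TopologicalSpace M]
  [DiscreteTopology M] {R : Type} [CommRing R] [Module R M] [TopologicalSpace R] [DiscreteTopology R]
  {p : ℕ} [hp : Fact p.Prime] [Algebra ℤ_[p] R] {cd : ConjugationDatum K} {ρ : DiscreteGaloisModule K M}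
  (D : DualityDatum p cd ρ R) (v : HeightOneSpectrum (𝓞 K))
  (V : Submodule ℤ M) (hV : ∀ σ : absoluteGaloisGroup (v.adicCompletion K), V ≤ V.comap (GaloisRep.toLocal v ρ σ))
  (V' : Submodule ℤ M)
  (hV' : ∀ σ : absoluteGaloisGroup (v.adicCompletion K), V' ≤ V'.comap (GaloisRep.toLocal v (cd.twist ρ) σ))

namespace DualityDatum

/-! ## §1 The restricted pairing `V × Tw(T)/V′ → R(1)` -/

/-- **The restricted pairing of a duality datum.**  If `D.e(V, V′) = 0` for a `Γ_{K_v}`-stable `V ≤ T` and a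
`Γ_{K_v}`-stable `V′ ≤ Tw(T)`, the pairing `e : T × Tw(T) → R(1)` descends to a continuous `Γ_{K_v}`-equivariant pairing
`P : V × (Tw(T)/V′) → R(1)|_{Γ_{K_v}}` on the tree's carriers (`ContinuousRep.subrepresentation`, `ContinuousRep.quotient`) with
`P(s, [t]) = e(s, t)` — Howard's `e_𝔭` restricted to `Fil_v T_𝔭 × Tw(T_𝔭)/Fil′`.
[cite: Howard2004HeegnerKolyvagin, §1.3 H.4 and Lemma 3.1.1 (arXiv p. 7 L69–82, p. 15 L60–62)] [cite: MilneADT2006, I §0] -/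
theorem exists_restrictedPairing (horth : ∀ s ∈ V, ∀ t ∈ V', D.e s t = 0) :
    ∃ P : ContPairing ((GaloisRep.toLocal v ρ).subrepresentation V hV).toTopRep
        ((GaloisRep.toLocal v (cd.twist ρ)).quotient V' hV').toTopRep (GaloisRep.toLocal v D.twistOne).toTopRep,
      ∀ (s : V) (t : M), P.toLin s (Submodule.Quotient.mk t) = D.e (s : M) t := by
  -- the descended bi-additive map
  let B₀ : V → (M ⧸ V') →ₗ[ℤ] R := fun s ↦
    V'.liftQ (D.e (s : M)).toAddMonoidHom.toIntLinearMap fun t ht ↦ by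
      change D.e (s : M) t = 0
      exact horth s s.2 t ht
  have hB₀ : ∀ (s : V) (t : M), B₀ s (Submodule.Quotient.mk t) = D.e (s : M) t := fun s t ↦ rfl
  let B : V →ₗ[ℤ] (M ⧸ V') →ₗ[ℤ] R :=
    { toFun := B₀
      map_add' := fun s s' ↦ by
        refine LinearMap.ext fun q ↦ ?_
        induction q using Submodule.Quotient.induction_on with
        | _ t => rw [LinearMap.add_apply, hB₀, hB₀, hB₀, Submodule.coe_add, map_add, LinearMap.add_apply]
      map_smul' := fun c s ↦ by
        refine LinearMap.ext fun q ↦ ?_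
        induction q using Submodule.Quotient.induction_on with
        | _ t =>
          rw [RingHom.id_apply, LinearMap.smul_apply, hB₀, hB₀, Submodule.coe_smul, ← LinearMap.flip_apply D.e,
            map_zsmul, LinearMap.flip_apply] }
  have hB : ∀ (s : V) (t : M), B s (Submodule.Quotient.mk t) = D.e (s : M) t := fun s t ↦ rfl
  refine ⟨ContPairing.ofDiscrete B fun σ s q ↦ ?_, fun s t ↦ rfl⟩
  induction q using Submodule.Quotient.induction_on with
  | _ t =>
    change B ⟨GaloisRep.toLocal v ρ σ (s : M), _⟩
        ((GaloisRep.toLocal v (cd.twist ρ)).quotient V' hV' σ (Submodule.Quotient.mk t)) =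
      GaloisRep.toLocal v D.twistOne σ (B s (Submodule.Quotient.mk t))
    rw [ContinuousRep.quotient_apply_mk, hB, hB]
    exact D.eHom_equivariant (absGaloisRestrict K _ σ) (s : M) t

/-! ## §2 Non-degeneracy of the cup product of the restricted pairing -/

section Nondegenerate

variable {D v V hV V' hV'} [CharZero (v.adicCompletion K)] {k : ℕ}
  (lam : R →+ ZMod (p ^ k))
  (hlam : ∀ (z : ℤ_[p]) (r : R), lam (algebraMap ℤ_[p] R z * r) = PadicInt.toZModPow k z * lam r)
  (exp : ZMod (p ^ k) →+ MuCarrier K (p ^ k))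
  (hexp : ∀ (g : absoluteGaloisGroup K) (x : ZMod (p ^ k)),
    exp (cyclotomicCharacterModPow K p k g * x) = mu K (p ^ k) g (exp x))
  (hexpb : Bijective exp)
  (P : ContPairing ((GaloisRep.toLocal v ρ).subrepresentation V hV).toTopRep
    ((GaloisRep.toLocal v (cd.twist ρ)).quotient V' hV').toTopRep (GaloisRep.toLocal v D.twistOne).toTopRep)
  (hP : ∀ (s : V) (t : M), P.toLin s (Submodule.Quotient.mk t) = D.e (s : M) t)
  (hM : ∀ m : M, (p ^ k) • m = 0)
  (hR : ∀ t : M, (∀ s ∈ V, lam (D.e s t) = 0) → t ∈ V')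
  (hS : ∀ φ : V →+ ZMod (p ^ k), ∃ t : M, ∀ s : V, lam (D.e (s : M) t) = φ s)

include hlam hexp hP hR hS hexpb in
/-- **The `μ_{p^k}(K̄_v)`-valued push of the restricted pairing is perfect at the module level** (auxiliary packaging of
(hR)/(hS) after `exp ∘ λ` and `μ_{p^k}(K̄) ≅ μ_{p^k}(K̄_v)`): there is a continuous equivariant `P′ : V × Tw(T)/V′ → μ_{p^k}(K̄_v)`
with `P′.cupProduct = H²(exp ∘ λ, transfer) ∘ P.cupProduct`, trivial right kernel and every additive `V → μ` represented.
[cite: Howard2004HeegnerKolyvagin, §1.3 H.4 and §2.1 (Hom_{S_𝔭}(N, 𝒟_𝔭(1)) ≅ Hom(N, μ_{p^∞}))] [cite: MilneADT2006, I §0] -/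
theorem exists_muPairing_restricted [Finite M] :
    letI : NeZero (p ^ k) := ⟨pow_ne_zero k hp.out.ne_zero⟩
    ∃ (P' : ContPairing ((GaloisRep.toLocal v ρ).subrepresentation V hV).toTopRep
        ((GaloisRep.toLocal v (cd.twist ρ)).quotient V' hV').toTopRep (mu (v.adicCompletion K) (p ^ k)).toTopRep)
      (γ : (GaloisRep.toLocal v D.twistOne).toTopRep ⟶ (mu (v.adicCompletion K) (p ^ k)).toTopRep),
      (∀ x y, cohomologyMap γ 2 (P.cupProduct x y) = P'.cupProduct x y) ∧
      (∀ b, (∀ a, P'.toLin a b = 0) → b = 0) ∧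
      (∀ f : V →+ MuCarrier (v.adicCompletion K) (p ^ k), ∃ b, ∀ a, P'.toLin a b = f a) := by
  haveI : NeZero (p ^ k) := ⟨pow_ne_zero k hp.out.ne_zero⟩
  -- the value map `R(1)|_v → μ(K̄) → μ(K̄_v)`, `r ↦ transfer (exp (λ r))`
  let γ₀ : R →+ MuCarrier (v.adicCompletion K) (p ^ k) :=
    (muTransfer K (v.adicCompletion K) (p ^ k)).comp (D.expLam lam exp)
  let γ : (GaloisRep.toLocal v D.twistOne).toTopRep ⟶ (mu (v.adicCompletion K) (p ^ k)).toTopRep :=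
    TopRep.ofHom
      { toContinuousLinearMap := ⟨γ₀.toIntLinearMap, continuous_of_discreteTopology⟩
        isIntertwining' := fun σ ↦ ContinuousLinearMap.ext fun r ↦ by
          change γ₀ (D.twistOne (absGaloisRestrict K (v.adicCompletion K) σ) r) = mu (v.adicCompletion K) (p ^ k) σ (γ₀ r)
          change muTransfer K (v.adicCompletion K) (p ^ k) (D.expLam lam exp (D.twistOne _ r)) =
            mu (v.adicCompletion K) (p ^ k) σ (muTransfer K (v.adicCompletion K) (p ^ k) (D.expLam lam exp r))
          rw [D.expLam_twistOne lam hlam exp hexp, muTransfer_mu] }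
  have hγ : ∀ r : R, γ.hom r = muTransfer K (v.adicCompletion K) (p ^ k) (exp (lam r)) := fun r ↦ rfl
  -- the pushed pairing
  let P' : ContPairing ((GaloisRep.toLocal v ρ).subrepresentation V hV).toTopRep
      ((GaloisRep.toLocal v (cd.twist ρ)).quotient V' hV').toTopRep (mu (v.adicCompletion K) (p ^ k)).toTopRep :=
    ContPairing.ofDiscrete (P.toLin.compr₂ γ.hom.toContinuousLinearMap.toLinearMap) fun σ a b ↦ by
      rw [LinearMap.compr₂_apply, LinearMap.compr₂_apply, P.toLin_smul]
      exact ContinuousRep.hom_comm_apply γ σ _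
  have hP' : ∀ a b, P'.toLin a b = γ.hom (P.toLin a b) := fun a b ↦ rfl
  refine ⟨P', γ, fun x y ↦ ?_, fun b hb ↦ ?_, fun f ↦ ?_⟩
  · -- cup products
    have h := ContPairing.cupProduct_map P P' (𝟙 _) (𝟙 _) γ (fun a b ↦ rfl) x y
    have hx : cohomologyMap (𝟙 ((GaloisRep.toLocal v ρ).subrepresentation V hV).toTopRep) 1 x = x := by
      rw [show cohomologyMap (𝟙 ((GaloisRep.toLocal v ρ).subrepresentation V hV).toTopRep) 1 = 𝟙 _ from
        ContinuousCohomology.map_id _ _]; rfl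
    have hy : cohomologyMap (𝟙 ((GaloisRep.toLocal v (cd.twist ρ)).quotient V' hV').toTopRep) 1 y = y := by
      rw [show cohomologyMap (𝟙 ((GaloisRep.toLocal v (cd.twist ρ)).quotient V' hV').toTopRep) 1 = 𝟙 _ from
        ContinuousCohomology.map_id _ _]; rfl
    rw [hx, hy] at h
    exact h
  · -- right kernel
    induction b using Submodule.Quotient.induction_on with
    | _ t =>
      refine (Submodule.Quotient.mk_eq_zero V').mpr (hR t fun s hs ↦ ?_)
      have h0 := hb ⟨s, hs⟩
      rw [hP', hP, hγ] at h0
      have h1 : exp (lam (D.e s t)) = 0 :=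
        muTransfer_injective K (v.adicCompletion K) (p ^ k) (by rw [h0, map_zero])
      exact hexpb.1 (by rw [h1, map_zero])
  · -- every additive `V → μ(K̄_v)` is represented
    let E : ZMod (p ^ k) ≃+ MuCarrier (v.adicCompletion K) (p ^ k) :=
      (AddEquiv.ofBijective exp hexpb).trans (muTransferEquiv K (v.adicCompletion K) (p ^ k))
    have hE : ∀ x, E x = muTransfer K (v.adicCompletion K) (p ^ k) (exp x) := fun x ↦ rfl
    obtain ⟨t, ht⟩ := hS (E.symm.toAddMonoidHom.comp f)
    refine ⟨Submodule.Quotient.mk t, fun a ↦ ?_⟩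
    rw [hP', hP, hγ, ht, ← hE]
    exact E.apply_symm_apply (f a)

include hP hM hR hS hexpb hlam hexp in
/-- **Right non-degeneracy of the cup product of the restricted pairing** `H¹(K_v, V) × H¹(K_v, Tw(T)/V′) → H²(K_v, R(1))`:
if `P(x, y) = 0` for all `x ∈ H¹(K_v, V)` then `y = 0` — the (Nondeg′) input at `v ∣ p` of the H.4 descent for the saturated
ordinary condition (`V = Fil_v T`, `V′ =` the transport of `Fil_v̄ T`).  Perfectness at the module level ((hR), (hS)) is read
through `λ`; the conclusion is in `H²(K_v, R(1))` with no invariant map.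
[cite: Howard2004HeegnerKolyvagin, §1.3 H.4, Lemma 3.1.1 and Def. 3.2.6 (arXiv p. 7 L78–82, p. 15 L60–62, p. 16 L108–110)]
[cite: MilneADT2006, I Cor. 2.3] [cite: SerreGaloisCohomology1997, II §5.2 Thm. 2] -/
theorem restrictedPairing_eq_zero_of_forall_cupProduct_eq_zero_right [Finite M]
    (y : galoisCohomology ((GaloisRep.toLocal v (cd.twist ρ)).quotient V' hV') 1)
    (hy : ∀ x : galoisCohomology ((GaloisRep.toLocal v ρ).subrepresentation V hV) 1, P.cupProduct x y = 0) : y = 0 := by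
  haveI : NeZero (p ^ k) := ⟨pow_ne_zero k hp.out.ne_zero⟩
  obtain ⟨P', γ, hcup, hinj, hsurj⟩ := exists_muPairing_restricted lam hlam exp hexp hexpb P hP hR hS
  refine ContPairing.eq_zero_of_forall_cupProduct_eq_zero_right (v.adicCompletion K)
    ((GaloisRep.toLocal v ρ).subrepresentation V hV) ((GaloisRep.toLocal v (cd.twist ρ)).quotient V' hV') P'
    (fun a ↦ Subtype.ext (by rw [Submodule.coe_smul_of_tower]; exact hM (a : M))) hinj hsurj y fun x ↦ ?_
  have h := hcup x y
  rw [hy, map_zero] at h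
  exact h.symm

include hP hM hR hS hexpb hlam hexp in
/-- **Left non-degeneracy of the cup product of the restricted pairing**: if `P(x, y) = 0` for all `y ∈ H¹(K_v, Tw(T)/V′)` then
`x = 0` in `H¹(K_v, V)`. [cite: Howard2004HeegnerKolyvagin, §1.3 H.4, Lemma 3.1.1 and Def. 3.2.6 (arXiv p. 7 L78–82, p. 15 L60–62)]
[cite: MilneADT2006, I Cor. 2.3] [cite: SerreGaloisCohomology1997, II §5.2 Thm. 2] -/
theorem restrictedPairing_eq_zero_of_forall_cupProduct_eq_zero_left [Finite M]
    (x : galoisCohomology ((GaloisRep.toLocal v ρ).subrepresentation V hV) 1)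
    (hx : ∀ y : galoisCohomology ((GaloisRep.toLocal v (cd.twist ρ)).quotient V' hV') 1, P.cupProduct x y = 0) : x = 0 := by
  haveI : NeZero (p ^ k) := ⟨pow_ne_zero k hp.out.ne_zero⟩
  obtain ⟨P', γ, hcup, hinj, hsurj⟩ := exists_muPairing_restricted lam hlam exp hexp hexpb P hP hR hS
  refine ContPairing.eq_zero_of_forall_cupProduct_eq_zero_left (v.adicCompletion K)
    ((GaloisRep.toLocal v ρ).subrepresentation V hV) ((GaloisRep.toLocal v (cd.twist ρ)).quotient V' hV') P'
    (fun a ↦ Subtype.ext (by rw [Submodule.coe_smul_of_tower]; exact hM (a : M))) hinj hsurj x fun y ↦ ?_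
  have h := hcup x y
  rw [hx, map_zero] at h
  exact h.symm

include hP hM hR hS hexpb hlam hexp in
/-- **Both kernels of the cup product of the restricted pairing are trivial** — the hypothesis shape (Nondeg′)/(Nondeg) of the
tree's limit statements `Tower.pow_smul_eq_zero_of_forall_pairing_eq_zero` / `…_of_range` for the pair of local towers
`H¹(K_v, Fil_v T/p^j) × H¹(K_v, Tw(T/p^j)/Fil′)`. [cite: Howard2004HeegnerKolyvagin, §1.3 H.4 and Def. 3.2.6 (arXiv p. 7 L78–82, p. 16 L108–110)]
[cite: MilneADT2006, I Cor. 2.3] -/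
theorem restrictedPairing_cupProduct_nondegenerate [Finite M] :
    (∀ x : galoisCohomology ((GaloisRep.toLocal v ρ).subrepresentation V hV) 1,
        (∀ y : galoisCohomology ((GaloisRep.toLocal v (cd.twist ρ)).quotient V' hV') 1, P.cupProduct x y = 0) → x = 0) ∧
      ∀ y : galoisCohomology ((GaloisRep.toLocal v (cd.twist ρ)).quotient V' hV') 1,
        (∀ x : galoisCohomology ((GaloisRep.toLocal v ρ).subrepresentation V hV) 1, P.cupProduct x y = 0) → y = 0 :=
  ⟨fun x hx ↦ restrictedPairing_eq_zero_of_forall_cupProduct_eq_zero_left lam hlam exp hexp hexpb P hP hM hR hS x hx,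
    fun y hy ↦ restrictedPairing_eq_zero_of_forall_cupProduct_eq_zero_right lam hlam exp hexp hexpb P hP hM hR hS y hy⟩

end Nondegenerate

end DualityDatum

end Literature.NumberTheory.GaloisCohomology.Howard2004

end
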